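import Summits.AtomisticToContinuum.HydrodynamicLimit.Theorems.InformationPercolationEnginePercolationClosesChaosForecastTransferArch
import Summits.AtomisticToContinuum.HydrodynamicLimit.Theorems.InformationPercolationEnginePercolationClosesChaosCesaroTransfer
import Summits.AtomisticToContinuum.HydrodynamicLimit.Theorems.InformationPercolationEnginePercolationClosesChaosForecastRetyped
import HarnessLib

/-!
# Forecast transfer S6 of the line `equilibrium-forecast-chain-rule` (crux `InformationPercolationEngine.PercolationClosesChaos`,
stmt-AtomisticToContinuum-15178) — piece H2: `MesoForecastChaos → BadForecastRare`

Support file (`--supports stmt-AtomisticToContinuum-15178`) of the registered stub `stub_forecastTransfer` (worker S6 of lead c3):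
the second hypothesis `BadForecastRare` of the architecture `kineticCellChaosLG_of` (piece A) is DISCHARGED from
`MesoForecastChaos` (skeleton v5: conjunct (a) of `MesoConditionalEquidistribution` v2 as a stand-alone statement,
`…ForecastRetyped.lean`) — consumed verbatim: its integrand is the architecture's
`𝟙{GoodUnit ∧ δ < gForecast (badWeight Ψ η T) k q}` by `rfl` — and the in-mean entropy transfer `G_N → LG` of
`exists_lgTransferConst` (piece T of S5): with `δ' = δ₂/2` and `L = 54 (log 2 + A)/δ₂`, the unit-fraction `V ∈ [0, 27]`
(`unitAvg_le_mul_card`, `h³ · #cellBox h ≤ 27` once `c ℓ_N ≤ 1`, `exists_mesh_le_one`) has `∫ V dLG ≤ δ' + 27 (log 2 + A)/L = δ₂`.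
Also: `gForecast_badWeight_eq_zero_of_not_mem` (forecasts vanish off the box, so the indicator families are box-supported).
-/

noncomputable section

open MeasureTheory Set Filter Topology
open scoped ENNReal BigOperators Classical
open Literature.Analysis.FluidPDE Literature.MathematicalPhysics.KineticTheory
open Literature.MathematicalPhysics.KineticTheory.VelocityBlindPlacement

namespace Summit.AtomisticToContinuum.HydrodynamicLimit.Theorems.EquilibriumForecastLine

/-! ## Unit averages of bounded box-supported families -/

/-- **A box-supported family bounded by `B ≥ 0` has unit average at most `B · h³ · #cellBox h`.** [folklore] -/
theorem unitAvg_le_mul_card {c σ : ℝ} {N : ℕ} (τ : ℝ) {F : ℕ → Cell → ℝ} {B : ℝ} (hh : 0 ≤ c * meanFreePath σ N)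
    (hB : 0 ≤ B) (hF : ∀ k, ∀ q ∉ cellBox (c * meanFreePath σ N), F k q = 0) (hFB : ∀ k q, F k q ≤ B) :
    unitAvg c σ N τ F ≤ B * ((c * meanFreePath σ N) ^ 3 * (cellBox (c * meanFreePath σ N)).card) := by
  rw [unitAvg_eq_sum c σ N τ F hF]
  set K := numSteps c σ N τ with hK
  set M := (cellBox (c * meanFreePath σ N)).card with hM
  have hsum : ∑ k ∈ Finset.range K, ∑ q ∈ cellBox (c * meanFreePath σ N), F k q ≤ (K : ℝ) * ((M : ℝ) * B) := by
    calc ∑ k ∈ Finset.range K, ∑ q ∈ cellBox (c * meanFreePath σ N), F k q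
        ≤ ∑ k ∈ Finset.range K, ∑ q ∈ cellBox (c * meanFreePath σ N), B :=
          Finset.sum_le_sum fun k _ => Finset.sum_le_sum fun q _ => hFB k q
      _ = (K : ℝ) * ((M : ℝ) * B) := by
          rw [Finset.sum_const, Finset.sum_const, Finset.card_range, nsmul_eq_mul, nsmul_eq_mul]
  rcases Nat.eq_zero_or_pos K with hK0 | hK0
  · rw [hK0, Finset.sum_range_zero, mul_zero]
    positivity
  · have hKr : (0 : ℝ) < K := by exact_mod_cast hK0
    calc ((K : ℝ))⁻¹ * (c * meanFreePath σ N) ^ 3 * ∑ k ∈ Finset.range K, ∑ q ∈ cellBox (c * meanFreePath σ N), F k q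
        ≤ ((K : ℝ))⁻¹ * (c * meanFreePath σ N) ^ 3 * ((K : ℝ) * ((M : ℝ) * B)) :=
          mul_le_mul_of_nonneg_left hsum (by positivity)
      _ = B * ((c * meanFreePath σ N) ^ 3 * M) := by
          field_simp

/-- A box-supported family with values `≤ 1` has unit average at most `27` once `h ≤ 1`. [folklore] -/
theorem unitAvg_le_twentySeven {c σ : ℝ} {N : ℕ} (τ : ℝ) {F : ℕ → Cell → ℝ} (hh : 0 < c * meanFreePath σ N)
    (h1 : c * meanFreePath σ N ≤ 1) (hF : ∀ k, ∀ q ∉ cellBox (c * meanFreePath σ N), F k q = 0)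
    (hF1 : ∀ k q, F k q ≤ 1) : unitAvg c σ N τ F ≤ 27 := by
  have h := unitAvg_le_mul_card τ hh.le zero_le_one hF hF1
  rw [one_mul] at h
  exact h.trans (card_cellBox_mul_le hh h1)

/-! ## Forecasts vanish off the box -/

/-- The `G_N`-forecast of the increment of a unit outside the box is the zero function (`badWeight` is identically `0` there,
`condExp` of `0` is `0`; `0 ≤ T`). [folklore] -/
theorem gForecast_badWeight_eq_zero_of_not_mem {σ : ℝ} {N : ℕ} (Φ : Flow σ N) {b c : ℝ} (hh : 0 < c * meanFreePath σ N)
    (Ψ : V3 × V3 × V3 → ℝ) (η : ℝ) {T : ℝ} (hT : 0 ≤ T) (k : ℕ) {q : Cell} (hq : q ∉ cellBox (c * meanFreePath σ N)) :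
    gForecast b c σ N Φ (badWeight Ψ η T c σ N Φ) k q = 0 := by
  unfold gForecast
  have h0 : badWeight Ψ η T c σ N Φ k q = 0 := funext fun z => badWeight_eq_zero_of_not_mem hh Ψ η hT Φ k hq z
  rw [h0, condExp_zero]

/-! ## H2 from forecast chaos under the invariant law -/

/-- **`MesoForecastChaos → BadForecastRare`** (H2 of the architecture, discharged; skeleton v5): `MesoForecastChaos` verbatim at
`(δ' = δ₂/2, L = 54 (log 2 + A)/δ₂)` and the in-mean transfer of `exists_lgTransferConst`. [folklore] -/
theorem badForecastRare_of_forecastChaos : MesoForecastChaos → BadForecastRare := by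
  intro hmce
  obtain ⟨φs, hφs, σ₁, hσ₁, H⟩ := hmce
  refine ⟨φs, hφs, σ₁, hσ₁, ?_⟩
  intro a₀ θ₀ u₀ ha hθ hu ha0 hθ0 σ hσ hσ₁' hhalf Φ τ hτ Ψ hΨ hΨb ϑs η δ T δ₂ hϑs hη hδ hT hδ₂
  obtain ⟨A, hA, hLG⟩ := exists_lgTransferConst ha hθ hu ha0 hθ0 hhalf
  have hl2 : 0 < Real.log 2 := Real.log_pos one_lt_two
  have hL : 0 < 54 * (Real.log 2 + A) / δ₂ := by positivity
  obtain ⟨ϑ, hϑ, c₀, hc₀, Hc⟩ := H σ hσ hσ₁' Φ τ hτ Ψ hΨ hΨb ϑs η δ T (δ₂ / 2) (54 * (Real.log 2 + A) / δ₂)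
    hϑs hη hδ hT (by positivity) hL
  refine ⟨ϑ, hϑ, c₀, hc₀, fun c hc b hb => ?_⟩
  obtain ⟨N₀, HN⟩ := Hc c hc b hb
  obtain ⟨N₁, HN₁⟩ := exists_mesh_le_one hσ c
  refine ⟨max N₀ N₁, fun N hN => ?_⟩
  have hN₀ : N₀ ≤ N := (le_max_left _ _).trans hN
  have hN₁ : N₁ ≤ N := (le_max_right _ _).trans hN
  have hc0 : 0 < c := hc₀.trans_le hc
  have hh : 0 < c * meanFreePath σ N := mul_pos hc0 (meanFreePath_pos hσ N)
  obtain ⟨-, -, -, -, htr⟩ := hLG N (Φ N)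
  -- the unit-fraction of good units with a bad forecast, as a function of the datum
  set V : Phase N → ℝ := fun z => unitAvg c σ N τ fun k q =>
    if GoodUnit ϑs ϑ φs c σ N ((Φ N).flow ((k : ℝ) * stepLen c σ N) z) q ∧
        δ < gForecast b c σ N (Φ N) (badWeight Ψ η T c σ N (Φ N)) k q z
    then 1 else 0 with hV
  have hbox : ∀ (z : Phase N) (k : ℕ), ∀ q ∉ cellBox (c * meanFreePath σ N),
      (if GoodUnit ϑs ϑ φs c σ N ((Φ N).flow ((k : ℝ) * stepLen c σ N) z) q ∧
          δ < gForecast b c σ N (Φ N) (badWeight Ψ η T c σ N (Φ N)) k q z then (1 : ℝ) else 0) = 0 := by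
    intro z k q hq
    rw [if_neg]
    rintro ⟨-, hlt⟩
    rw [gForecast_badWeight_eq_zero_of_not_mem (Φ N) hh Ψ η hT.le k hq, Pi.zero_apply] at hlt
    exact lt_irrefl _ (hδ.trans hlt)
  have hV0 : ∀ z, 0 ≤ V z := fun z =>
    unitAvg_nonneg hh.le (hbox z) fun k q => by positivity
  have hV27 : ∀ z, V z ≤ 27 := fun z =>
    unitAvg_le_twentySeven τ hh (HN₁ N hN₁) (hbox z) fun k q => by split_ifs <;> norm_num
  have hE : eqLaw σ N (Φ N) {z | δ₂ / 2 < V z} ≤ ENNReal.ofReal (Real.exp (-(54 * (Real.log 2 + A) / δ₂ * ((N : ℝ) + 1)))) :=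
    HN N hN₀
  have hint := htr V (δ₂ / 2) 27 (54 * (Real.log 2 + A) / δ₂) (by positivity) (by norm_num) hV0 hV27 hL hE
  have hcalc : δ₂ / 2 + 27 * ((Real.log 2 + A) / (54 * (Real.log 2 + A) / δ₂)) = δ₂ := by
    have hne : Real.log 2 + A ≠ 0 := by positivity
    field_simp
    ring
  calc unitMean c σ N τ (localGibbsLaw σ a₀ u₀ θ₀ N (Φ N)) (fun k q z =>
        if GoodUnit ϑs ϑ φs c σ N ((Φ N).flow ((k : ℝ) * stepLen c σ N) z) q ∧
            δ < gForecast b c σ N (Φ N) (badWeight Ψ η T c σ N (Φ N)) k q z then 1 else 0)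
      = ∫ z, V z ∂(localGibbsLaw σ a₀ u₀ θ₀ N (Φ N)) := rfl
    _ ≤ δ₂ / 2 + 27 * ((Real.log 2 + A) / (54 * (Real.log 2 + A) / δ₂)) := hint
    _ = δ₂ := hcalc

/-- **`MesoConditionalEquidistribution → BadForecastRare`** (the v2-typed form of H2, registered in cycle 4 before the re-typing):
through conjunct (a). [folklore] -/
theorem badForecastRare_of_mce : MesoConditionalEquidistribution → BadForecastRare :=
  fun h => badForecastRare_of_forecastChaos (mesoForecastChaos_of h)

end Summit.AtomisticToContinuum.HydrodynamicLimit.Theorems.EquilibriumForecastLine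

end
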